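import Summits.Ventures.HSemireg.WedgeHankelRecurrenceGaussChebyshevCAntiFixedPointMixed

/-!
# Venture HSemireg — **`(T_m − 1, T_n − 1) = (T_{gcd(m,n)} − 1)` AS IDEALS OF `R[X]` FOR EVERY COMMUTATIVE RING `R`, WITH NO HYPOTHESIS ON `2`** (upgrading N490, which assumed `2 ∈ Rˣ`): over `ℤ`
# cancel the non-zero-divisor `2` from N490's `(2(T_m − 1), 2(T_n − 1)) = (2(T_g − 1))`, then base-change the resulting Bézout identity along `ℤ[X] → R[X]`; hence **`T_m(x) = 1 ∧ T_n(x) = 1 ⟺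
# T_{gcd}(x) = 1` for every `x` in every commutative ring** and **`gcd(T_m(a) − 1, T_n(a) − 1) = |T_{gcd(m,n)}(a) − 1|`** for every integer `a`

HONEST FRAMING. Part of the Lean index of the computation cell `pub-hsemireg` (seat p10 gen 48, Sunday typer «UNIFORM-IN-n»).  Polynomial ideal algebra only; no variety, no cohomology theory, no sheaf,
no Ext group and no semiregularity map is constructed here; nothing here says that HC / HC_CM / HC_AV holds; no Literature fact (unproved `Prop`) is declared or used.  Custodian versions as in
`WedgeHankelSiegelIdeal` (1/3).
SOURCES (cited).  T. J. Rivlin, *Chebyshev Polynomials* (1990), §1.2, Ch. 4; R. Lidl, G. L. Mullen, G. Turnwald, *Dickson Polynomials* (1993), Ch. 3.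
PROOF TYPED HERE.  N490 `chebyshevT_two_mul_sub_one_span_pair`; N488 `chebyshevT_eval_eq_one_of_eval_eq_one`; N476 `int_gcd_eq_natAbs_of_span_pair_eq`; Mathlib `Ideal.mem_span_pair`, `Ideal.mem_span_singleton'`,
`mul_left_cancel₀`, `Polynomial.mapRingHom`, `Polynomial.Chebyshev.map_T`, `Ideal.map_span`, `Polynomial.evalRingHom`.
DEDUP DISCLOSURE (`rg -n 'span_pair_eq_span_singleton_of_mul_left|chebyshevT_sub_one_span_pair_int|chebyshevT_sub_one_span_pair_allRings|chebyshevT_eval_eq_one_iff_gcd_allRings|chebyshevT_int_eval_sub_one_gcd'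
Summits Literature HarnessLib`, 2026-09-04): N490 (the `IsUnit 2` versions), N477 (`gcd(T_m(a), T_n(a))`); 0 hits for the 5 names below.

WHAT IS IN THE TREE.  N476, N477, N488, N490.
THIS FILE (namespace `Summit.Ventures.HSemireg.Wedge.HankelOuter` continued; CHAINED on N494; 0 definitions):
* §1260 `span_pair_eq_span_singleton_of_mul_left` (cancelling a non-zero-divisor from a two-generator ideal identity), `chebyshevT_sub_one_span_pair_int`, **`chebyshevT_sub_one_span_pair_allRings`**,
  **`chebyshevT_eval_eq_one_iff_gcd_allRings`**, **`chebyshevT_int_eval_sub_one_gcd`**.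
CAVEATS.  Nothing Ext-side.  New names only.
-/

open Module Polynomial
open scoped Matrix Polynomial

namespace Summit.Ventures.HSemireg.Wedge.HankelOuter

/-! ## §1260. `(T_m − 1, T_n − 1) = (T_g − 1)` in every `R[X]` -/

/-- If `d` is left-cancellable (`d ≠ 0` in a domain) and `(d a, d b) = (d c)`, then `(a, b) = (c)`. [bookkeeping; this file, §1260] -/
theorem span_pair_eq_span_singleton_of_mul_left {A : Type*} [CommRing A] [IsDomain A] {d : A} (hd : d ≠ 0) {a b c : A}
    (h : Ideal.span {d * a, d * b} = Ideal.span {d * c}) : Ideal.span {a, b} = Ideal.span {c} := by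
  apply le_antisymm
  · rw [Ideal.span_le, Set.insert_subset_iff, Set.singleton_subset_iff, SetLike.mem_coe, SetLike.mem_coe, Ideal.mem_span_singleton', Ideal.mem_span_singleton']
    have ha : d * a ∈ Ideal.span {d * c} := h ▸ Ideal.subset_span (Set.mem_insert _ _)
    have hb : d * b ∈ Ideal.span {d * c} := h ▸ Ideal.subset_span (Set.mem_insert_of_mem _ (Set.mem_singleton _))
    obtain ⟨α, hα⟩ := Ideal.mem_span_singleton'.1 ha
    obtain ⟨β, hβ⟩ := Ideal.mem_span_singleton'.1 hb
    exact ⟨⟨α, mul_left_cancel₀ hd (by linear_combination hα)⟩, ⟨β, mul_left_cancel₀ hd (by linear_combination hβ)⟩⟩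
  · rw [Ideal.span_singleton_le_iff_mem, Ideal.mem_span_pair]
    have hc : d * c ∈ Ideal.span {d * a, d * b} := h ▸ Ideal.subset_span (Set.mem_singleton _)
    obtain ⟨α, β, hαβ⟩ := Ideal.mem_span_pair.1 hc
    exact ⟨α, β, mul_left_cancel₀ hd (by linear_combination hαβ)⟩

/-- Over `ℤ`: `(T_m − 1, T_n − 1) = (T_{gcd(m,n)} − 1)` in `ℤ[X]` (cancel `2` from N490). [this file, §1260] -/
theorem chebyshevT_sub_one_span_pair_int (m n : ℕ) :
    Ideal.span {Polynomial.Chebyshev.T ℤ (m : ℤ) - 1, Polynomial.Chebyshev.T ℤ (n : ℤ) - 1} = Ideal.span {Polynomial.Chebyshev.T ℤ (Nat.gcd m n : ℤ) - 1} :=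
  span_pair_eq_span_singleton_of_mul_left (two_ne_zero : (2 : ℤ[X]) ≠ 0) (chebyshevT_two_mul_sub_one_span_pair (R := ℤ) m n)

/-- **`(T_m − 1, T_n − 1) = (T_{gcd(m,n)} − 1)` in `R[X]` for EVERY commutative ring `R`** (base change of the integral Bézout identity). [Rivlin §1.2; this file, §1260] -/
theorem chebyshevT_sub_one_span_pair_allRings {R : Type*} [CommRing R] (m n : ℕ) :
    Ideal.span {Polynomial.Chebyshev.T R (m : ℤ) - 1, Polynomial.Chebyshev.T R (n : ℤ) - 1} = Ideal.span {Polynomial.Chebyshev.T R (Nat.gcd m n : ℤ) - 1} := by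
  have h := congrArg (Ideal.map (Polynomial.mapRingHom (Int.castRingHom R))) (chebyshevT_sub_one_span_pair_int m n)
  rwa [Ideal.map_span, Ideal.map_span, Set.image_pair, Set.image_singleton, map_sub, map_sub, map_sub, map_one, Polynomial.coe_mapRingHom, Polynomial.Chebyshev.map_T,
    Polynomial.Chebyshev.map_T, Polynomial.Chebyshev.map_T] at h

/-- **`T_m(x) = 1` and `T_n(x) = 1` iff `T_{gcd(m,n)}(x) = 1`**, for every `x` in every commutative ring. [this file, §1260] -/
theorem chebyshevT_eval_eq_one_iff_gcd_allRings {R : Type*} [CommRing R] (m n : ℕ) (x : R) :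
    (Polynomial.Chebyshev.T R (m : ℤ)).eval x = 1 ∧ (Polynomial.Chebyshev.T R (n : ℤ)).eval x = 1 ↔ (Polynomial.Chebyshev.T R (Nat.gcd m n : ℤ)).eval x = 1 := by
  constructor
  · rintro ⟨hm, hn⟩
    have hmem : Polynomial.Chebyshev.T R (Nat.gcd m n : ℤ) - 1 ∈ Ideal.span {Polynomial.Chebyshev.T R (m : ℤ) - 1, Polynomial.Chebyshev.T R (n : ℤ) - 1} := by
      rw [chebyshevT_sub_one_span_pair_allRings]; exact Ideal.subset_span (Set.mem_singleton _)
    obtain ⟨a, b, hab⟩ := Ideal.mem_span_pair.1 hmem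
    have h := congrArg (Polynomial.eval x) hab
    rw [eval_add, eval_mul, eval_mul, eval_sub, eval_sub, eval_sub, hm, hn, eval_one, sub_self, mul_zero, mul_zero, add_zero] at h
    exact (sub_eq_zero.1 h.symm)
  · intro hg
    obtain ⟨m', hm'⟩ := Nat.gcd_dvd_left m n
    obtain ⟨n', hn'⟩ := Nat.gcd_dvd_right m n
    refine ⟨?_, ?_⟩
    · have h := chebyshevT_eval_eq_one_of_eval_eq_one (R := R) (m' : ℤ) (Nat.gcd m n : ℤ) hg
      rwa [← Nat.cast_mul, mul_comm, ← hm'] at h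
    · have h := chebyshevT_eval_eq_one_of_eval_eq_one (R := R) (n' : ℤ) (Nat.gcd m n : ℤ) hg
      rwa [← Nat.cast_mul, mul_comm, ← hn'] at h

/-- **`gcd(T_m(a) − 1, T_n(a) − 1) = |T_{gcd(m,n)}(a) − 1|`** for every integer `a` (e.g. `a = 2`: the numbers `T_n(2) − 1 = 0, 1, 6, 25, 96, …`). [this file, §1260] -/
theorem chebyshevT_int_eval_sub_one_gcd (a : ℤ) (m n : ℕ) :
    Int.gcd ((Polynomial.Chebyshev.T ℤ (m : ℤ)).eval a - 1) ((Polynomial.Chebyshev.T ℤ (n : ℤ)).eval a - 1) = ((Polynomial.Chebyshev.T ℤ (Nat.gcd m n : ℤ)).eval a - 1).natAbs := by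
  have hev : ∀ k : ℕ, Polynomial.evalRingHom a (Polynomial.Chebyshev.T ℤ (k : ℤ) - 1) = (Polynomial.Chebyshev.T ℤ (k : ℤ)).eval a - 1 := fun k => by
    rw [map_sub, map_one, Polynomial.coe_evalRingHom]
  have h := congrArg (Ideal.map (Polynomial.evalRingHom a)) (chebyshevT_sub_one_span_pair_int m n)
  rw [Ideal.map_span, Ideal.map_span, Set.image_pair, Set.image_singleton, hev, hev, hev] at h
  exact int_gcd_eq_natAbs_of_span_pair_eq h

end Summit.Ventures.HSemireg.Wedge.HankelOuter
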